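import Summits.FinalStateConjecture.FinalStateConjecture.Theses.StorageCertificates
import Literature.Geometry.Lorentzian.BlackHoles
import Literature.Geometry.Lorentzian.Sweep2
import HarnessLib

/-!
# Birth skeleton — crux stmt-FinalStateConjecture-10928 `Theses.StorageCertificates.CertificatesToKerrCapture` (rank 9)
# line `birth` (skeleton registrar planner-skel-stmt-FinalStateConjecture-10928-0, 2026-08-17; BC3 of run/shared/lean/lens3/_common/BC.md)

The crux is the route's PROGRAMME CLAIM `CertificateFamily → K`: the uniform storage-function
certificates on every DRSR-admissible superradiant box (`CertificateFamily`, rank 2) yield the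
waypoint `K` = sub-extremal Kerr capture (Dafermos–Rodnianski Conj. 5.1 in consequence form over
the inhabited `VacuumCauchyDevelopment`, spelled out inline in the crux and in
`FinalStateFromKerrCapture`; here the legend `KerrCapture`, with
`certificatesToKerrCapture_iff : CertificatesToKerrCapture ↔ (CertificateFamily → KerrCapture)`
proved by `Iff.rfl`). The cut follows the route header's own TWO-LAYER PLAN for this node —
"CertificatesToKerrCapture ⇐ ThresholdCertificates → WhitingFreeILED → (ILED ⇒ K, the
Ma–Szeftel/Hintz architecture)" — typed as FOUR stubs after locating exactly where mode stability
enters the printed proof of integrated decay on sub-extremal Kerr (held text of arXiv:1402.7034,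
DRSR III): Theorem 8.1 (phase-space ILED) carries on its right-hand side the horizon term
`1_{ω_low ≤ |ω| ≤ ω_high, Λ ≤ ε_width⁻¹ω_high²} |u(−∞)|²`, produced ONLY by the bounded
non-stationary range `𝓖_♭ ∩ {|ω| ≥ ω_low}` (Prop. 8.7.4: `b ∫_{R₋*}^{R₊*} (|u'|² + |u|²) ≤
B (|ω(ω − ω₊m)| |u|²)_{r=r₊} − ∫ (2y Re(u'H̄) − Eω Im(H̄u))`, "it is only for the sake of the
superradiant frequencies for which we include the first term"), and bounded in Prop. 9.7.1 by
`B ∫_{Σ₀} J^N[ψ]` through the quantitative mode stability of Shlapentokh-Rothman (arXiv:1302.6902,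
Thm. 1.7 of the held text = "Thm. 1.9" as cited by DRSR; its core is `sup_𝒜 |W⁻¹| ≤ G`, the
Wronskian of the Whiting-transformed problem). A certificate for a frequency triple is precisely a
way to prove Prop. 8.7.4 WITHOUT the horizon term: its two end inequalities sign the boundary
forms, so they can be dropped. Hence:

* `stub_coreEstimate` (S1, CERTIFICATE SOUNDNESS ON THE WHOLE TORTOISE LINE; M, provable now):
  `CertificateFamily →` for every box `(M, a₀, ω_h, Λ_h, ε, δ, R_c)` ONE constant `C` such that
  for all spins `0 ≤ a ≤ a₀`, tortoise functions `R`, admissible triples in the superradiant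
  ε-interior `ε ≤ ω ≤ mω₊ − ε`, and all `C²` solutions `u` of `u'' + (ω² − V(R x)) u = F`
  (`V` the printed potential, inlined exactly as in `CertificateFamily`) with `F` continuous,
  `‖F‖(‖u'‖ + ‖u‖)` integrable, outgoing at `r → ∞` (`u − A e^{iωx} → 0` with its derivative) and
  ingoing at `𝓗⁺` (`u − B e^{−ikx} → 0` with its derivative, `k = ω − mω₊`):
  `∫_{x₁}^{x₂} (‖u'‖² + ‖u‖²) ≤ C ∫_ℝ ‖F‖(‖u'‖ + ‖u‖)` whenever `r₊(1+δ) ≤ R x₁ ≤ R x₂ ≤ R_c`.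
  Proof = the energy identity of the support item `CertificateEstimate` run on `[X₁, X₂]` and
  the limits `X₁ → −∞`, `X₂ → +∞` (`limsup Q(X₂) ≤ 0 ≤ liminf Q(X₁)` from the asymptotics and
  the two end inequalities), `C = 2/η`.
* `stub_thresholdEstimate` (S2, THRESHOLD WINDOW; M/L, the line's sharpest killable bet — the
  header's "ThresholdCertificates", stated by its OUTPUT so as not to guess the `k`-adapted end
  conditions): for every box and every `ω₀ > 0` there are a window `ε > 0` and a constant `C`
  such that the same bilinear core estimate holds for admissible triples with `ω₀ ≤ ω`,
  `|ω − mω₊| ≤ ε` (both sides of the superradiant threshold, `k = 0` included, where the horizon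
  condition reads `u → B`, `u' → 0`). True in print through `sup |W⁻¹| < ∞` on compact frequency
  sets away from `ω = 0` INCLUDING thresholds (arXiv:1302.6902 Thm. 1.6 + the quantitative
  theorem; arXiv:1910.02854); the Whiting-free proof asks for certificates whose margin survives
  `k → 0`.
* `stub_iledOfCoreEstimates` (S3, WHITING-FREE ILED; XL — "formalise DRSR III with Prop. 9.7.1
  replaced"): `CoreEstimate → ThresholdEstimate → KerrWaveILED`, the latter VERBATIM the body of
  the named fact `drsr_wave_integrated_decay_kerr` (`KerrWaveDecay.lean`, DRSR Thm. 3.2 (25),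
  `j = 2`, local consequence form: `∫₀^∞ E_loc(τ, R) dτ ≤ C(M, a, R) · E₂[ψ](0)` for admissible
  waves), restated over the Kerr-wave vocabulary (`IsAdmissibleKerrWave`, `localSliceEnergy`,
  `sliceSobolevEnergy`) so that the fact module and its eleven-fact cone are NOT imported, as the
  route header prescribes; `Iff.rfl` links the two in any file importing both.
* `stub_kerrCaptureOfILED` (S4, THE ARCHITECTURE; open-problem-sized in-tree, in print modulo the
  rendering of K): `KerrWaveILED → KerrCapture` — nonlinear stability of the sub-extremal Kerr
  exterior in the tree's form from linear decay: the Teukolsky analogue of S1–S3 (spin ±2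
  certificates replacing arXiv:1910.02854 inside arXiv:2007.07211/2302.08916), then the
  GCM/modulation scheme (arXiv:2104.11857, arXiv:2205.14808; `a = 0`: arXiv:2104.08222; full
  range: Hintz arXiv:2606.28253 as cited by the route header; robustness: arXiv:2410.02341).

Composition `CertificatesToKerrCapture_of : Sig.stub_coreEstimate → Sig.stub_thresholdEstimate →
Sig.stub_iledOfCoreEstimates → Sig.stub_kerrCaptureOfILED → CertificatesToKerrCapture` (real proof:
`fun h₁ h₂ h₃ h₄ hCF ↦ h₄ (h₃ (h₁ hCF) h₂)`), and `certificatesToKerrCapture_of_stubs :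
CertificatesToKerrCapture` = the crux BY NAME modulo the four stubs. The `Sig.*` legend = the stub
signatures verbatim; the registered stubs themselves are def-free and self-contained (fully
qualified names; only `CertificateFamily` of the route file is referenced, in S1).

Conventions (all inherited from `CertificateFamily`, arXiv:1402.7034 §4.2): spins `0 ≤ a ≤ a₀`,
the branch `ω > 0`; `x` is the tortoise coordinate (`dR/dx = Δ/(R² + a²)`), `k = ω − mω₊` the
horizon frequency, `P(x) = ω² − V(R x)` with `P(−∞) = k²`, `P(+∞) = ω²`; outgoing = `e^{iωx}` at
`+∞`, ingoing = `e^{−ikx}` at `−∞` (DRSR (eq:b±), §5.3; the Robin conditions of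
`CertificateCompleteness`/`CertificateEstimate` are their compact model). The mirror branches
`(ω, m) ↦ (−ω, −m)` (complex conjugation) and `a ↦ −a` (`φ ↦ −φ`), the ranges `|ω| ≤ ω_low`,
`𝓖_♯`, `𝓖^♯`, `𝓖_♮`, `𝓖_{<♭}` (DRSR's own currents, no mode stability) and the non-superradiant
bounded range (`Q^T` identity: `ω|u₊|² + k|u₋|² = ∫ Im(F ū)`, harmless up to the threshold from
that side) are obligations of S3, not separate stubs.

Disproof.lean: none exists for this crux (`ledger crux ls stmt-FinalStateConjecture-10928`: no
workfiles, no crux ideas at registration), so there is no `_false_without_` obligation to honour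
and no landed Negative lemma to check the stubs against. Negatives index (1 entry,
`not_UniformPhotonSphereChannels`): an unrelated fixed-mass photon-sphere channel estimate; no
stub asserts a uniform-in-frequency sojourn bound of that kind. Refuter note on the crux
(g40-11, 2026-08-15): "10928 is implied by K-in-print (Hintz) … value is provenance" — the
skeleton makes the provenance checkable: S1 is where certificates are CONSUMED, S2 names the one
frequency window `CertificateFamily` does not cover, S3/S4 are the printed architecture.

Imports: the route file; `Literature.Geometry.Lorentzian.BlackHoles` (`IsAdmissibleKerrWave`) and
`Literature.Geometry.Lorentzian.Sweep2` (`sliceSobolevEnergy`) for the Kerr-wave vocabulary of S3/S4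
(their named facts are `def … : Prop`, used nowhere here); `HarnessLib`.
-/


set_option linter.dupNamespace false

noncomputable section

open scoped BigOperators Topology Manifold Classical MeasureTheory ProbabilityTheory Matrix InnerProductSpace ComplexConjugate ContinuousMap
open Filter Set Function TopologicalSpace MeasureTheory

namespace Summit.FinalStateConjecture.FinalStateConjecture.Cruxes.CertificatesToKerrCapture.Birth

open Summit.FinalStateConjecture.FinalStateConjecture.Theses.StorageCertificates (CertificateFamily CertificatesToKerrCapture)

/-! ## Legend: the waypoint and the two frequency-space interfaces, as named propositions -/

/-- **Legend: the waypoint `K` (sub-extremal Kerr capture)** — VERBATIM the consequent of the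
crux `CertificatesToKerrCapture` (and the antecedent of `FinalStateFromKerrCapture`): there are
`(s, δ, k)` such that for every sub-extremal `(M, a)` and `η > 0` some `ε > 0` makes every
vacuum-constraint solution on the horizon-penetrating Kerr–Schild slice `Kerr.slice a M` within
`H^s_δ`-distance `ε` of `Kerr.data M a M` have all its maximal vacuum Cauchy developments with
(i) `η`-close sub-extremal final parameters, (ii) complete `𝓘⁺` in the far-origin sojourn form,
(iii) a region converging in `Cᵏ` to `g_{M′,a′}` (`Spacetime.ConvergesToKerr`). Dafermos–Rodnianski
arXiv:0811.0354 Conj. 5.1 in consequence form over `VacuumCauchyDevelopment` (route header). -/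
def KerrCapture : Prop :=
  ∀ [Literature.Geometry.Lorentzian.Kerr.Facts] [Literature.Geometry.Lorentzian.Kerr.SliceFacts], ∃ (s : ℕ) (δ : ℝ) (k : ℕ), ∀ (M a : ℝ) (h : Literature.Geometry.Lorentzian.Kerr.IsSubextremal M a), ∀ η > (0 : ℝ), ∃ ε > (0 : ℝ), ∀ (D : Literature.Geometry.Lorentzian.InitialDataSet 𝓘(ℝ, Literature.Geometry.Lorentzian.E3) (Literature.Geometry.Lorentzian.Kerr.slice a M)) [D.metric.HasLeviCivita], D.IsVacuumConstraintSolution → Literature.Geometry.Lorentzian.InitialDataSet.dataWeightedSobolevEDist s δ D (Literature.Geometry.Lorentzian.Kerr.data M a M h.pos.le) < ENNReal.ofReal ε → ∀ 𝒟 : Literature.Geometry.Lorentzian.VacuumCauchyDevelopment D, 𝒟.IsMaximal → ∃ (M' a' : ℝ) (𝒟oc : Set 𝒟.carrier), Literature.Geometry.Lorentzian.Kerr.IsSubextremal M' a' ∧ |M' - M| + |a' - a| ≤ η ∧ (∀ [𝒟.metric.HasLeviCivita], ∃ B₀ : Set (Literature.Geometry.Lorentzian.Kerr.slice a M), IsCompact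 B₀ ∧ ∀ σ : ℝ, 0 < σ → ∃ B₁ : Set (Literature.Geometry.Lorentzian.Kerr.slice a M), IsCompact B₁ ∧ ∀ p : Literature.Geometry.Lorentzian.Kerr.slice a M, Literature.Geometry.Lorentzian.Kerr.afRadius a M + 1 ≤ ‖(p : Literature.Geometry.Lorentzian.E3)‖ → p ∉ B₁ → ∀ (γ : ℝ → 𝒟.carrier) (dom : Set ℝ), 𝒟.metric.IsNormalisedNullRayFrom 𝒟.timeOrientation 𝒟.embed 𝒟.normal p γ dom → ¬ BddAbove dom ∨ ENNReal.ofReal σ ≤ Literature.Geometry.Lorentzian.sojournTime γ dom (𝒟.metric.causalFuture 𝒟.timeOrientation (𝒟.embed '' B₀))) ∧ 𝒟.toSpacetime.ConvergesToKerr 𝒟oc M' a' k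

/-- The crux is literally `CertificateFamily → KerrCapture` (syntactic identity of the inline
waypoint, checked by `Iff.rfl`; cf. the planner's Bridge.lean `subextremalKerrCapture_iff`). -/
theorem certificatesToKerrCapture_iff :
    CertificatesToKerrCapture ↔ (CertificateFamily → KerrCapture) :=
  Iff.rfl

/-- **Legend: `CoreEstimate` — the bounded-frequency core estimate WITHOUT horizon term
(superradiant ε-interior).** Quantifier prefix identical to `CertificateFamily`
(`M > 0`, `0 ≤ a₀ < M`, box `ω_h, Λ_h`, threshold distance `ε > 0`, core `[r₊(1+δ), R_c]`, then ONE
constant `C`, then `0 ≤ a ≤ a₀`, a tortoise radius function `R` — `dR/dx = Δ(R)/(R² + a²)`,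
`R > r₊`, `R → r₊` at `−∞`, `R → ∞` at `+∞` — and an admissible triple `Λ ≥ |m|(|m|+1)`,
`Λ ≥ 2|amω|`, `|ω| ≤ ω_h`, `Λ ≤ Λ_h`, `ε ≤ ω ≤ mω₊ − ε`); then, with `k = ω − mω₊`, for every `C²`
pair `(u, u')` on `ℝ` solving Carter's inhomogeneous radial equation `u'' + (ω² − V(R x)) u = F`
(DRSR III (CartersODE); `V` the printed potential of arXiv:1402.7034 §5.2.3 inlined exactly as in
`CertificateFamily`, `= Kerr.sepPotential` by `Kerr.sepPotential_eq`) with `F` continuous and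
`‖F‖(‖u'‖ + ‖u‖)` integrable, OUTGOING at `r → ∞` (`u − A e^{iωx} → 0` and
`u' − iωA e^{iωx} → 0` as `x → +∞`) and INGOING at `𝓗⁺` (`u − B e^{−ikx} → 0`,
`u' + ikB e^{−ikx} → 0` as `x → −∞`; DRSR (eq:b±), §5.3, p. 21 of the held text), the bilinear
estimate `∫_{x₁}^{x₂} (‖u'‖² + ‖u‖²) ≤ C ∫_ℝ ‖F‖(‖u'‖ + ‖u‖)` on every window
`r₊(1+δ) ≤ R x₁ ≤ R x₂ ≤ R_c`. This is Prop. 8.7.4 of arXiv:1402.7034 for these frequencies with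
the horizon term `B(|ω(ω − ω₊m)| |u|²)_{r=r₊}` REMOVED — the term whose control (Prop. 9.7.1) is
the only use of quantitative mode stability (arXiv:1302.6902) in DRSR III. Implies real-mode
exclusion on the box (take `F = 0`). The integrability binder keeps the Bochner integral honest
(typing checklist (ii)). -/
def CoreEstimate : Prop :=
  ∀ (M a₀ : ℝ), 0 < M → 0 ≤ a₀ → a₀ < M → ∀ (ωh Λh ε δ Rc : ℝ), 0 < ε → 0 < δ → ∃ C : ℝ, ∀ (a : ℝ), 0 ≤ a → a ≤ a₀ → ∀ (R : ℝ → ℝ), (∀ x, HasDerivAt R (((R x) ^ 2 - 2 * M * R x + a ^ 2) / ((R x) ^ 2 + a ^ 2)) x) → (∀ x, Literature.Geometry.Lorentzian.Kerr.rPlus M a < R x) → Filter.Tendsto R Filter.atBot (nhds (Literature.Geometry.Lorentzian.Kerr.rPlus M a)) → Filter.Tendsto R Filter.atTop Filter.atTop → ∀ (ω Λ : ℝ) (m : ℤ), |(m : ℝ)| * (|(m : ℝ)| + 1) ≤ Λ → 2 * |a * m * ω| ≤ Λ → |ω| ≤ ωh → Λ ≤ Λh → ε ≤ ω → ω + ε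 ≤ m * Literature.Geometry.Lorentzian.Kerr.horizonAngularVelocity M a → ∀ (k : ℝ), k = ω - m * Literature.Geometry.Lorentzian.Kerr.horizonAngularVelocity M a → ∀ (u u₁ u₂ F : ℝ → ℂ), (∀ x, HasDerivAt u (u₁ x) x ∧ HasDerivAt u₁ (u₂ x) x) → Continuous F → MeasureTheory.Integrable (fun x ↦ ‖F x‖ * (‖u₁ x‖ + ‖u x‖)) → (∀ (x r P : ℝ), r = R x → P = ω ^ 2 - ((4 * M * r * a * m * ω - a ^ 2 * (m : ℝ) ^ 2 + (r ^ 2 - 2 * M * r + a ^ 2) * Λ) / (r ^ 2 + a ^ 2) ^ 2 + (r ^ 2 - 2 * M * r + a ^ 2) * (3 * r ^ 2 - 4 * M * r + a ^ 2) / (r ^ 2 + a ^ 2) ^ 3 - 3 * (r ^ 2 - 2 * M * r + a ^ 2) ^ 2 * r ^ 2 / (r ^ 2 + a ^ 2) ^ 4) → u₂ x + (P : ℂ) * u x = F x) → (∃ A : ℂ, Filter.Tendsto (fun x : ℝ ↦ u x - A * Complex.exp (Complex.I * ω * x)) Filter.atTop (nhds 0) ∧ Filter.Tendsto (fun x : ℝ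 ↦ u₁ x - Complex.I * ω * A * Complex.exp (Complex.I * ω * x)) Filter.atTop (nhds 0)) → (∃ B : ℂ, Filter.Tendsto (fun x : ℝ ↦ u x - B * Complex.exp (-(Complex.I * k * x))) Filter.atBot (nhds 0) ∧ Filter.Tendsto (fun x : ℝ ↦ u₁ x + Complex.I * k * B * Complex.exp (-(Complex.I * k * x))) Filter.atBot (nhds 0)) → ∀ (x₁ x₂ : ℝ), x₁ ≤ x₂ → Literature.Geometry.Lorentzian.Kerr.rPlus M a * (1 + δ) ≤ R x₁ → R x₂ ≤ Rc → ∫ x in x₁..x₂, (‖u₁ x‖ ^ 2 + ‖u x‖ ^ 2) ≤ C * ∫ x, ‖F x‖ * (‖u₁ x‖ + ‖u x‖)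

/-- **Legend: `ThresholdEstimate` — the same bilinear core estimate on SOME uniform window around
the superradiant threshold `ω = mω₊`.** For every box `(M, a₀, ω_h, Λ_h)`, every `ω₀ > 0` and
core `[r₊(1+δ), R_c]` there are a window `ε > 0` and a constant `C` such that, for `0 ≤ a ≤ a₀`,
tortoise `R`, admissible triples with `|ω| ≤ ω_h`, `Λ ≤ Λ_h`, `ω₀ ≤ ω`, `|ω − mω₊| ≤ ε`, and
`(u, F)` as in `CoreEstimate` (at `k = ω − mω₊ = 0` the horizon condition reads `u → B`,
`u' → 0`: regularity at `𝓗⁺`), `∫_{x₁}^{x₂} (‖u'‖² + ‖u‖²) ≤ C ∫_ℝ ‖F‖(‖u'‖ + ‖u‖)` on core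
windows. The window `CertificateFamily` leaves out (its certificates live on `ε ≤ ω ≤ mω₊ − ε`);
the route header's foreseen node "ThresholdCertificates", stated by its output. -/
def ThresholdEstimate : Prop :=
  ∀ (M a₀ : ℝ), 0 < M → 0 ≤ a₀ → a₀ < M → ∀ (ωh Λh ω₀ δ Rc : ℝ), 0 < ω₀ → 0 < δ → ∃ ε : ℝ, 0 < ε ∧ ∃ C : ℝ, ∀ (a : ℝ), 0 ≤ a → a ≤ a₀ → ∀ (R : ℝ → ℝ), (∀ x, HasDerivAt R (((R x) ^ 2 - 2 * M * R x + a ^ 2) / ((R x) ^ 2 + a ^ 2)) x) → (∀ x, Literature.Geometry.Lorentzian.Kerr.rPlus M a < R x) → Filter.Tendsto R Filter.atBot (nhds (Literature.Geometry.Lorentzian.Kerr.rPlus M a)) → Filter.Tendsto R Filter.atTop Filter.atTop → ∀ (ω Λ : ℝ) (m : ℤ), |(m : ℝ)| * (|(m : ℝ)| + 1) ≤ Λ → 2 * |a * m * ω| ≤ Λ → |ω| ≤ ωh → Λ ≤ Λh → ω₀ ≤ ω → |ω - m * Literature.Geometry.Lorentzian.Kerr.horizonAngularVelocity M a| ≤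 ε → ∀ (k : ℝ), k = ω - m * Literature.Geometry.Lorentzian.Kerr.horizonAngularVelocity M a → ∀ (u u₁ u₂ F : ℝ → ℂ), (∀ x, HasDerivAt u (u₁ x) x ∧ HasDerivAt u₁ (u₂ x) x) → Continuous F → MeasureTheory.Integrable (fun x ↦ ‖F x‖ * (‖u₁ x‖ + ‖u x‖)) → (∀ (x r P : ℝ), r = R x → P = ω ^ 2 - ((4 * M * r * a * m * ω - a ^ 2 * (m : ℝ) ^ 2 + (r ^ 2 - 2 * M * r + a ^ 2) * Λ) / (r ^ 2 + a ^ 2) ^ 2 + (r ^ 2 - 2 * M * r + a ^ 2) * (3 * r ^ 2 - 4 * M * r + a ^ 2) / (r ^ 2 + a ^ 2) ^ 3 - 3 * (r ^ 2 - 2 * M * r + a ^ 2) ^ 2 * r ^ 2 / (r ^ 2 + a ^ 2) ^ 4) → u₂ x + (P : ℂ) * u x = F x) → (∃ A : ℂ, Filter.Tendsto (fun x : ℝ ↦ u x - A * Complex.exp (Complex.I * ω * x)) Filter.atTop (nhds 0) ∧ Filter.Tendsto (fun x : ℝ ↦ u₁ x - Complex.I * ω * A * Complex.exp (Complex.I *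 ω * x)) Filter.atTop (nhds 0)) → (∃ B : ℂ, Filter.Tendsto (fun x : ℝ ↦ u x - B * Complex.exp (-(Complex.I * k * x))) Filter.atBot (nhds 0) ∧ Filter.Tendsto (fun x : ℝ ↦ u₁ x + Complex.I * k * B * Complex.exp (-(Complex.I * k * x))) Filter.atBot (nhds 0)) → ∀ (x₁ x₂ : ℝ), x₁ ≤ x₂ → Literature.Geometry.Lorentzian.Kerr.rPlus M a * (1 + δ) ≤ R x₁ → R x₂ ≤ Rc → ∫ x in x₁..x₂, (‖u₁ x‖ ^ 2 + ‖u x‖ ^ 2) ≤ C * ∫ x, ‖F x‖ * (‖u₁ x‖ + ‖u x‖)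

/-- **Legend: `KerrWaveILED` — integrated local energy decay for admissible scalar waves on every
sub-extremal Kerr exterior**, VERBATIM the body of the named fact
`Literature.Geometry.Lorentzian.drsr_wave_integrated_decay_kerr` (`KerrWaveDecay.lean`;
Dafermos–Rodnianski–Shlapentokh-Rothman arXiv:1402.7034 Thm. 3.2, estimate (25) with `j = 2`,
vendored local consequence): for `|a| < M` and every coordinate radius `R` a constant `C < ∞`,
uniform in `ψ`, with `∫₀^∞ E_loc(τ, R) dτ ≤ C · E₂[ψ](0)` for every admissible wave
(`IsAdmissibleKerrWave`: smooth, `□_g ψ = 0` on `{r > r₊}`, data compactly supported in the open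
leaf `{t* = 0}`), `E_loc = localSliceEnergy`, `E₂ = sliceSobolevEnergy … 0 2 0 univ`. Restated here
(not imported) so that the fact module's cone stays out, as the route header prescribes for the
node "WhitingFreeILED"; `Iff.rfl` identifies the two in any file importing both. -/
def KerrWaveILED : Prop :=
  ∀ [Literature.Geometry.Lorentzian.Kerr.Facts] [Literature.Geometry.Lorentzian.Kerr.SliceFacts] (M a : ℝ), Literature.Geometry.Lorentzian.Kerr.IsSubextremal M a → ∀ R : ℝ, ∃ C : ENNReal, C < ⊤ ∧ ∀ ψ : Literature.Geometry.Lorentzian.Kerr.exterior M a → ℝ, Literature.Geometry.Lorentzian.IsAdmissibleKerrWave M a ψ → ∫⁻ τ in Set.Ioi (0 : ℝ), Literature.Geometry.Lorentzian.localSliceEnergy (Literature.Geometry.Lorentzian.Kerr.exterior M a) ψ τ R ≤ C * Literature.Geometry.Lorentzian.sliceSobolevEnergy (Literature.Geometry.Lorentzian.Kerr.exterior M a) ψ 0 2 0 Set.univ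

/-! ## Legend: the four stub statements (verbatim the registered signatures) -/

/-- Statement of `stub_coreEstimate` (S1): `CertificateFamily → CoreEstimate`. -/
def Sig.stub_coreEstimate : Prop :=
  Summit.FinalStateConjecture.FinalStateConjecture.Theses.StorageCertificates.CertificateFamily → ∀ (M a₀ : ℝ), 0 < M → 0 ≤ a₀ → a₀ < M → ∀ (ωh Λh ε δ Rc : ℝ), 0 < ε → 0 < δ → ∃ C : ℝ, ∀ (a : ℝ), 0 ≤ a → a ≤ a₀ → ∀ (R : ℝ → ℝ), (∀ x, HasDerivAt R (((R x) ^ 2 - 2 * M * R x + a ^ 2) / ((R x) ^ 2 + a ^ 2)) x) → (∀ x, Literature.Geometry.Lorentzian.Kerr.rPlus M a < R x) → Filter.Tendsto R Filter.atBot (nhds (Literature.Geometry.Lorentzian.Kerr.rPlus M a)) → Filter.Tendsto R Filter.atTop Filter.atTop → ∀ (ω Λ : ℝ) (m : ℤ), |(m : ℝ)| * (|(m : ℝ)| + 1) ≤ Λ → 2 * |a * m * ω| ≤ Λ → |ω| ≤ ωh → Λ ≤ Λh → ε ≤ ω → ω + ε ≤ m * Literature.Geometry.Lorentzian.Kerr.horizonAngularVelocity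 M a → ∀ (k : ℝ), k = ω - m * Literature.Geometry.Lorentzian.Kerr.horizonAngularVelocity M a → ∀ (u u₁ u₂ F : ℝ → ℂ), (∀ x, HasDerivAt u (u₁ x) x ∧ HasDerivAt u₁ (u₂ x) x) → Continuous F → MeasureTheory.Integrable (fun x ↦ ‖F x‖ * (‖u₁ x‖ + ‖u x‖)) → (∀ (x r P : ℝ), r = R x → P = ω ^ 2 - ((4 * M * r * a * m * ω - a ^ 2 * (m : ℝ) ^ 2 + (r ^ 2 - 2 * M * r + a ^ 2) * Λ) / (r ^ 2 + a ^ 2) ^ 2 + (r ^ 2 - 2 * M * r + a ^ 2) * (3 * r ^ 2 - 4 * M * r + a ^ 2) / (r ^ 2 + a ^ 2) ^ 3 - 3 * (r ^ 2 - 2 * M * r + a ^ 2) ^ 2 * r ^ 2 / (r ^ 2 + a ^ 2) ^ 4) → u₂ x + (P : ℂ) * u x = F x) → (∃ A : ℂ, Filter.Tendsto (fun x : ℝ ↦ u x - A * Complex.exp (Complex.I * ω * x)) Filter.atTop (nhds 0) ∧ Filter.Tendsto (fun x : ℝ ↦ u₁ x - Complex.I * ω * A * Complex.exp (Complex.I *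 ω * x)) Filter.atTop (nhds 0)) → (∃ B : ℂ, Filter.Tendsto (fun x : ℝ ↦ u x - B * Complex.exp (-(Complex.I * k * x))) Filter.atBot (nhds 0) ∧ Filter.Tendsto (fun x : ℝ ↦ u₁ x + Complex.I * k * B * Complex.exp (-(Complex.I * k * x))) Filter.atBot (nhds 0)) → ∀ (x₁ x₂ : ℝ), x₁ ≤ x₂ → Literature.Geometry.Lorentzian.Kerr.rPlus M a * (1 + δ) ≤ R x₁ → R x₂ ≤ Rc → ∫ x in x₁..x₂, (‖u₁ x‖ ^ 2 + ‖u x‖ ^ 2) ≤ C * ∫ x, ‖F x‖ * (‖u₁ x‖ + ‖u x‖)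

/-- Statement of `stub_thresholdEstimate` (S2): `ThresholdEstimate`. -/
def Sig.stub_thresholdEstimate : Prop :=
  ∀ (M a₀ : ℝ), 0 < M → 0 ≤ a₀ → a₀ < M → ∀ (ωh Λh ω₀ δ Rc : ℝ), 0 < ω₀ → 0 < δ → ∃ ε : ℝ, 0 < ε ∧ ∃ C : ℝ, ∀ (a : ℝ), 0 ≤ a → a ≤ a₀ → ∀ (R : ℝ → ℝ), (∀ x, HasDerivAt R (((R x) ^ 2 - 2 * M * R x + a ^ 2) / ((R x) ^ 2 + a ^ 2)) x) → (∀ x, Literature.Geometry.Lorentzian.Kerr.rPlus M a < R x) → Filter.Tendsto R Filter.atBot (nhds (Literature.Geometry.Lorentzian.Kerr.rPlus M a)) → Filter.Tendsto R Filter.atTop Filter.atTop → ∀ (ω Λ : ℝ) (m : ℤ), |(m : ℝ)| * (|(m : ℝ)| + 1) ≤ Λ → 2 * |a * m * ω| ≤ Λ → |ω| ≤ ωh → Λ ≤ Λh → ω₀ ≤ ω → |ω - m * Literature.Geometry.Lorentzian.Kerr.horizonAngularVelocity M a| ≤ ε → ∀ (k : ℝ), k = ω - m * Literature.Geometry.Lorentzian.Kerr.horizonAngularVelocity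 M a → ∀ (u u₁ u₂ F : ℝ → ℂ), (∀ x, HasDerivAt u (u₁ x) x ∧ HasDerivAt u₁ (u₂ x) x) → Continuous F → MeasureTheory.Integrable (fun x ↦ ‖F x‖ * (‖u₁ x‖ + ‖u x‖)) → (∀ (x r P : ℝ), r = R x → P = ω ^ 2 - ((4 * M * r * a * m * ω - a ^ 2 * (m : ℝ) ^ 2 + (r ^ 2 - 2 * M * r + a ^ 2) * Λ) / (r ^ 2 + a ^ 2) ^ 2 + (r ^ 2 - 2 * M * r + a ^ 2) * (3 * r ^ 2 - 4 * M * r + a ^ 2) / (r ^ 2 + a ^ 2) ^ 3 - 3 * (r ^ 2 - 2 * M * r + a ^ 2) ^ 2 * r ^ 2 / (r ^ 2 + a ^ 2) ^ 4) → u₂ x + (P : ℂ) * u x = F x) → (∃ A : ℂ, Filter.Tendsto (fun x : ℝ ↦ u x - A * Complex.exp (Complex.I * ω * x)) Filter.atTop (nhds 0) ∧ Filter.Tendsto (fun x : ℝ ↦ u₁ x - Complex.I * ω * A * Complex.exp (Complex.I * ω * x)) Filter.atTop (nhds 0)) → (∃ B : ℂ, Filter.Tendsto (fun x : ℝ ↦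 u x - B * Complex.exp (-(Complex.I * k * x))) Filter.atBot (nhds 0) ∧ Filter.Tendsto (fun x : ℝ ↦ u₁ x + Complex.I * k * B * Complex.exp (-(Complex.I * k * x))) Filter.atBot (nhds 0)) → ∀ (x₁ x₂ : ℝ), x₁ ≤ x₂ → Literature.Geometry.Lorentzian.Kerr.rPlus M a * (1 + δ) ≤ R x₁ → R x₂ ≤ Rc → ∫ x in x₁..x₂, (‖u₁ x‖ ^ 2 + ‖u x‖ ^ 2) ≤ C * ∫ x, ‖F x‖ * (‖u₁ x‖ + ‖u x‖)

/-- Statement of `stub_iledOfCoreEstimates` (S3): `CoreEstimate → ThresholdEstimate → KerrWaveILED`. -/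
def Sig.stub_iledOfCoreEstimates : Prop :=
  (∀ (M a₀ : ℝ), 0 < M → 0 ≤ a₀ → a₀ < M → ∀ (ωh Λh ε δ Rc : ℝ), 0 < ε → 0 < δ → ∃ C : ℝ, ∀ (a : ℝ), 0 ≤ a → a ≤ a₀ → ∀ (R : ℝ → ℝ), (∀ x, HasDerivAt R (((R x) ^ 2 - 2 * M * R x + a ^ 2) / ((R x) ^ 2 + a ^ 2)) x) → (∀ x, Literature.Geometry.Lorentzian.Kerr.rPlus M a < R x) → Filter.Tendsto R Filter.atBot (nhds (Literature.Geometry.Lorentzian.Kerr.rPlus M a)) → Filter.Tendsto R Filter.atTop Filter.atTop → ∀ (ω Λ : ℝ) (m : ℤ), |(m : ℝ)| * (|(m : ℝ)| + 1) ≤ Λ → 2 * |a * m * ω| ≤ Λ → |ω| ≤ ωh → Λ ≤ Λh → ε ≤ ω → ω + ε ≤ m * Literature.Geometry.Lorentzian.Kerr.horizonAngularVelocity M a → ∀ (k : ℝ), k = ω - m * Literature.Geometry.Lorentzian.Kerr.horizonAngularVelocity M a → ∀ (u u₁ u₂ F : ℝ → ℂ), (∀ x, HasDerivAt u (u₁ x)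 x ∧ HasDerivAt u₁ (u₂ x) x) → Continuous F → MeasureTheory.Integrable (fun x ↦ ‖F x‖ * (‖u₁ x‖ + ‖u x‖)) → (∀ (x r P : ℝ), r = R x → P = ω ^ 2 - ((4 * M * r * a * m * ω - a ^ 2 * (m : ℝ) ^ 2 + (r ^ 2 - 2 * M * r + a ^ 2) * Λ) / (r ^ 2 + a ^ 2) ^ 2 + (r ^ 2 - 2 * M * r + a ^ 2) * (3 * r ^ 2 - 4 * M * r + a ^ 2) / (r ^ 2 + a ^ 2) ^ 3 - 3 * (r ^ 2 - 2 * M * r + a ^ 2) ^ 2 * r ^ 2 / (r ^ 2 + a ^ 2) ^ 4) → u₂ x + (P : ℂ) * u x = F x) → (∃ A : ℂ, Filter.Tendsto (fun x : ℝ ↦ u x - A * Complex.exp (Complex.I * ω * x)) Filter.atTop (nhds 0) ∧ Filter.Tendsto (fun x : ℝ ↦ u₁ x - Complex.I * ω * A * Complex.exp (Complex.I * ω * x)) Filter.atTop (nhds 0)) → (∃ B : ℂ, Filter.Tendsto (fun x : ℝ ↦ u x - B * Complex.exp (-(Complex.I * k * x))) Filter.atBot (nhds 0) ∧ Filter.Tendsto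 (fun x : ℝ ↦ u₁ x + Complex.I * k * B * Complex.exp (-(Complex.I * k * x))) Filter.atBot (nhds 0)) → ∀ (x₁ x₂ : ℝ), x₁ ≤ x₂ → Literature.Geometry.Lorentzian.Kerr.rPlus M a * (1 + δ) ≤ R x₁ → R x₂ ≤ Rc → ∫ x in x₁..x₂, (‖u₁ x‖ ^ 2 + ‖u x‖ ^ 2) ≤ C * ∫ x, ‖F x‖ * (‖u₁ x‖ + ‖u x‖)) → (∀ (M a₀ : ℝ), 0 < M → 0 ≤ a₀ → a₀ < M → ∀ (ωh Λh ω₀ δ Rc : ℝ), 0 < ω₀ → 0 < δ → ∃ ε : ℝ, 0 < ε ∧ ∃ C : ℝ, ∀ (a : ℝ), 0 ≤ a → a ≤ a₀ → ∀ (R : ℝ → ℝ), (∀ x, HasDerivAt R (((R x) ^ 2 - 2 * M * R x + a ^ 2) / ((R x) ^ 2 + a ^ 2)) x) → (∀ x, Literature.Geometry.Lorentzian.Kerr.rPlus M a < R x) → Filter.Tendsto R Filter.atBot (nhds (Literature.Geometry.Lorentzian.Kerr.rPlus M a)) → Filter.Tendsto R Filter.atTop Filter.atTop → ∀ (ω Λ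 : ℝ) (m : ℤ), |(m : ℝ)| * (|(m : ℝ)| + 1) ≤ Λ → 2 * |a * m * ω| ≤ Λ → |ω| ≤ ωh → Λ ≤ Λh → ω₀ ≤ ω → |ω - m * Literature.Geometry.Lorentzian.Kerr.horizonAngularVelocity M a| ≤ ε → ∀ (k : ℝ), k = ω - m * Literature.Geometry.Lorentzian.Kerr.horizonAngularVelocity M a → ∀ (u u₁ u₂ F : ℝ → ℂ), (∀ x, HasDerivAt u (u₁ x) x ∧ HasDerivAt u₁ (u₂ x) x) → Continuous F → MeasureTheory.Integrable (fun x ↦ ‖F x‖ * (‖u₁ x‖ + ‖u x‖)) → (∀ (x r P : ℝ), r = R x → P = ω ^ 2 - ((4 * M * r * a * m * ω - a ^ 2 * (m : ℝ) ^ 2 + (r ^ 2 - 2 * M * r + a ^ 2) * Λ) / (r ^ 2 + a ^ 2) ^ 2 + (r ^ 2 - 2 * M * r + a ^ 2) * (3 * r ^ 2 - 4 * M * r + a ^ 2) / (r ^ 2 + a ^ 2) ^ 3 - 3 * (r ^ 2 - 2 * M * r + a ^ 2) ^ 2 * r ^ 2 / (r ^ 2 + a ^ 2) ^ 4) → u₂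 x + (P : ℂ) * u x = F x) → (∃ A : ℂ, Filter.Tendsto (fun x : ℝ ↦ u x - A * Complex.exp (Complex.I * ω * x)) Filter.atTop (nhds 0) ∧ Filter.Tendsto (fun x : ℝ ↦ u₁ x - Complex.I * ω * A * Complex.exp (Complex.I * ω * x)) Filter.atTop (nhds 0)) → (∃ B : ℂ, Filter.Tendsto (fun x : ℝ ↦ u x - B * Complex.exp (-(Complex.I * k * x))) Filter.atBot (nhds 0) ∧ Filter.Tendsto (fun x : ℝ ↦ u₁ x + Complex.I * k * B * Complex.exp (-(Complex.I * k * x))) Filter.atBot (nhds 0)) → ∀ (x₁ x₂ : ℝ), x₁ ≤ x₂ → Literature.Geometry.Lorentzian.Kerr.rPlus M a * (1 + δ) ≤ R x₁ → R x₂ ≤ Rc → ∫ x in x₁..x₂, (‖u₁ x‖ ^ 2 + ‖u x‖ ^ 2) ≤ C * ∫ x, ‖F x‖ * (‖u₁ x‖ + ‖u x‖)) → ∀ [Literature.Geometry.Lorentzian.Kerr.Facts] [Literature.Geometry.Lorentzian.Kerr.SliceFacts] (M a : ℝ), Literature.Geometry.Lorentzian.Kerr.IsSubextremal M a → ∀ R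 : ℝ, ∃ C : ENNReal, C < ⊤ ∧ ∀ ψ : Literature.Geometry.Lorentzian.Kerr.exterior M a → ℝ, Literature.Geometry.Lorentzian.IsAdmissibleKerrWave M a ψ → ∫⁻ τ in Set.Ioi (0 : ℝ), Literature.Geometry.Lorentzian.localSliceEnergy (Literature.Geometry.Lorentzian.Kerr.exterior M a) ψ τ R ≤ C * Literature.Geometry.Lorentzian.sliceSobolevEnergy (Literature.Geometry.Lorentzian.Kerr.exterior M a) ψ 0 2 0 Set.univ

/-- Statement of `stub_kerrCaptureOfILED` (S4): `KerrWaveILED → KerrCapture`. -/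
def Sig.stub_kerrCaptureOfILED : Prop :=
  (∀ [Literature.Geometry.Lorentzian.Kerr.Facts] [Literature.Geometry.Lorentzian.Kerr.SliceFacts] (M a : ℝ), Literature.Geometry.Lorentzian.Kerr.IsSubextremal M a → ∀ R : ℝ, ∃ C : ENNReal, C < ⊤ ∧ ∀ ψ : Literature.Geometry.Lorentzian.Kerr.exterior M a → ℝ, Literature.Geometry.Lorentzian.IsAdmissibleKerrWave M a ψ → ∫⁻ τ in Set.Ioi (0 : ℝ), Literature.Geometry.Lorentzian.localSliceEnergy (Literature.Geometry.Lorentzian.Kerr.exterior M a) ψ τ R ≤ C * Literature.Geometry.Lorentzian.sliceSobolevEnergy (Literature.Geometry.Lorentzian.Kerr.exterior M a) ψ 0 2 0 Set.univ) → ∀ [Literature.Geometry.Lorentzian.Kerr.Facts] [Literature.Geometry.Lorentzian.Kerr.SliceFacts], ∃ (s : ℕ) (δ : ℝ) (k : ℕ), ∀ (M a : ℝ) (h : Literature.Geometry.Lorentzian.Kerr.IsSubextremal M a), ∀ η > (0 : ℝ), ∃ ε > (0 : ℝ), ∀ (D : Literature.Geometry.Lorentzian.InitialDataSet 𝓘(ℝ,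 Literature.Geometry.Lorentzian.E3) (Literature.Geometry.Lorentzian.Kerr.slice a M)) [D.metric.HasLeviCivita], D.IsVacuumConstraintSolution → Literature.Geometry.Lorentzian.InitialDataSet.dataWeightedSobolevEDist s δ D (Literature.Geometry.Lorentzian.Kerr.data M a M h.pos.le) < ENNReal.ofReal ε → ∀ 𝒟 : Literature.Geometry.Lorentzian.VacuumCauchyDevelopment D, 𝒟.IsMaximal → ∃ (M' a' : ℝ) (𝒟oc : Set 𝒟.carrier), Literature.Geometry.Lorentzian.Kerr.IsSubextremal M' a' ∧ |M' - M| + |a' - a| ≤ η ∧ (∀ [𝒟.metric.HasLeviCivita], ∃ B₀ : Set (Literature.Geometry.Lorentzian.Kerr.slice a M), IsCompact B₀ ∧ ∀ σ : ℝ, 0 < σ → ∃ B₁ : Set (Literature.Geometry.Lorentzian.Kerr.slice a M), IsCompact B₁ ∧ ∀ p : Literature.Geometry.Lorentzian.Kerr.slice a M, Literature.Geometry.Lorentzian.Kerr.afRadius a M + 1 ≤ ‖(p : Literature.Geometry.Lorentzian.E3)‖ → p ∉ B₁ → ∀ (γ : ℝ → 𝒟.carrier) (dom : Set ℝ), 𝒟.metric.IsNormalisedNullRayFrom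 𝒟.timeOrientation 𝒟.embed 𝒟.normal p γ dom → ¬ BddAbove dom ∨ ENNReal.ofReal σ ≤ Literature.Geometry.Lorentzian.sojournTime γ dom (𝒟.metric.causalFuture 𝒟.timeOrientation (𝒟.embed '' B₀))) ∧ 𝒟.toSpacetime.ConvergesToKerr 𝒟oc M' a' k

theorem sig_stub_coreEstimate_iff : Sig.stub_coreEstimate ↔ (CertificateFamily → CoreEstimate) :=
  Iff.rfl

theorem sig_stub_thresholdEstimate_iff : Sig.stub_thresholdEstimate ↔ ThresholdEstimate :=
  Iff.rfl

theorem sig_stub_iledOfCoreEstimates_iff :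
    Sig.stub_iledOfCoreEstimates ↔ (CoreEstimate → ThresholdEstimate → KerrWaveILED) :=
  Iff.rfl

theorem sig_stub_kerrCaptureOfILED_iff : Sig.stub_kerrCaptureOfILED ↔ (KerrWaveILED → KerrCapture) :=
  Iff.rfl

/-! ## Registered stubs (`sorry` only here; signatures def-free and self-contained) -/

/-- **S1 — CERTIFICATE SOUNDNESS ON THE WHOLE TORTOISE LINE** (`CertificateFamily → CoreEstimate`;
the place where the certificates are CONSUMED). Given the box, take `η > 0` and, frequency by
frequency, the normalised `C¹` storage form `𝕄 = [[α, β], [β̄, γ]]` of `CertificateFamily`; for a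
solution `z = (u', u)` of `u'' + P u = F` the storage `Q = α‖u'‖² + 2 Re(β ū' u) + γ‖u‖²` obeys
`Q' = z†H_𝕄z + 2 Re(α ū'F + β F̄ u)` with `H_𝕄 = [[α' + 2Re β, β' + γ − αP], [·, γ' − 2P Re β]] ⪰ 0`
on `ℝ` and `⪰ η𝟙` on the core (the `h11, h22, h12` clauses), and `|2 Re(α ū'F + β F̄u)| ≤
2‖F‖(‖u'‖ + ‖u‖)` by `sup|α|, sup‖β‖ ≤ 1`; integrating over `[X₁, X₂] ⊇ [x₁, x₂]` and letting
`X₂ → +∞`, `X₁ → −∞`: the outgoing asymptotics and `Re β → 0`, `α → α₊`, `Im β → b₊`, `γ → γ₊`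
give `limsup Q(X₂) = (γ₊ + ω²α₊ + 2ωb₊)|A|² ≤ 0`, the ingoing ones give
`liminf Q(X₁) = (γ₋ + k²α₋ − 2kb₋)|B|² ≥ 0` (the two end inequalities of `CertificateFamily`), whence
`η ∫_{x₁}^{x₂} (‖u'‖² + ‖u‖²) ≤ 2 ∫_ℝ ‖F‖(‖u'‖ + ‖u‖)`, i.e. `C = 2/η`. The non-compact analogue of
the support item `CertificateEstimate` (same algebra; limits instead of Robin ends). Why it might
fail: only by a slip between the two inlinings (potential clause, sign of `k`, orientation of the
end inequalities) — all copied verbatim from `CertificateFamily`, whose end lines were derived for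
exactly `u' = iωu` at `+∞` and `u' = −iku` at `−∞`. Size: M (provable now: FTC on `[X₁, X₂]`,
`intervalIntegral.integral_eq_sub_of_hasDerivAt`, limits along `atTop/atBot`, monotone
convergence for the nonnegative bulk). Sources: doi:10.1007/BF00276493 (Willems, dissipation
inequality), arXiv:1402.7034 Prop. 8.7.4 and §5.3, the route's `CertificateEstimate`. -/
theorem stub_coreEstimate : Summit.FinalStateConjecture.FinalStateConjecture.Theses.StorageCertificates.CertificateFamily → ∀ (M a₀ : ℝ), 0 < M → 0 ≤ a₀ → a₀ < M → ∀ (ωh Λh ε δ Rc : ℝ), 0 < ε → 0 < δ → ∃ C : ℝ, ∀ (a : ℝ), 0 ≤ a → a ≤ a₀ → ∀ (R : ℝ → ℝ), (∀ x, HasDerivAt R (((R x) ^ 2 - 2 * M * R x + a ^ 2) / ((R x) ^ 2 + a ^ 2)) x) → (∀ x, Literature.Geometry.Lorentzian.Kerr.rPlus M a < R x) → Filter.Tendsto R Filter.atBot (nhds (Literature.Geometry.Lorentzian.Kerr.rPlus M a)) → Filter.Tendsto R Filter.atTop Filter.atTop → ∀ (ω Λ : ℝ) (m : ℤ), |(m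 : ℝ)| * (|(m : ℝ)| + 1) ≤ Λ → 2 * |a * m * ω| ≤ Λ → |ω| ≤ ωh → Λ ≤ Λh → ε ≤ ω → ω + ε ≤ m * Literature.Geometry.Lorentzian.Kerr.horizonAngularVelocity M a → ∀ (k : ℝ), k = ω - m * Literature.Geometry.Lorentzian.Kerr.horizonAngularVelocity M a → ∀ (u u₁ u₂ F : ℝ → ℂ), (∀ x, HasDerivAt u (u₁ x) x ∧ HasDerivAt u₁ (u₂ x) x) → Continuous F → MeasureTheory.Integrable (fun x ↦ ‖F x‖ * (‖u₁ x‖ + ‖u x‖)) → (∀ (x r P : ℝ), r = R x → P = ω ^ 2 - ((4 * M * r * a * m * ω - a ^ 2 * (m : ℝ) ^ 2 + (r ^ 2 - 2 * M * r + a ^ 2) * Λ) / (r ^ 2 + a ^ 2) ^ 2 + (r ^ 2 - 2 * M * r + a ^ 2) * (3 * r ^ 2 - 4 * M * r + a ^ 2) / (r ^ 2 + a ^ 2) ^ 3 - 3 * (r ^ 2 - 2 * M * r + a ^ 2) ^ 2 * r ^ 2 / (r ^ 2 + a ^ 2) ^ 4) → u₂ x + (P : ℂ) * u x = F x) → (∃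 A : ℂ, Filter.Tendsto (fun x : ℝ ↦ u x - A * Complex.exp (Complex.I * ω * x)) Filter.atTop (nhds 0) ∧ Filter.Tendsto (fun x : ℝ ↦ u₁ x - Complex.I * ω * A * Complex.exp (Complex.I * ω * x)) Filter.atTop (nhds 0)) → (∃ B : ℂ, Filter.Tendsto (fun x : ℝ ↦ u x - B * Complex.exp (-(Complex.I * k * x))) Filter.atBot (nhds 0) ∧ Filter.Tendsto (fun x : ℝ ↦ u₁ x + Complex.I * k * B * Complex.exp (-(Complex.I * k * x))) Filter.atBot (nhds 0)) → ∀ (x₁ x₂ : ℝ), x₁ ≤ x₂ → Literature.Geometry.Lorentzian.Kerr.rPlus M a * (1 + δ) ≤ R x₁ → R x₂ ≤ Rc → ∫ x in x₁..x₂, (‖u₁ x‖ ^ 2 + ‖u x‖ ^ 2) ≤ C * ∫ x, ‖F x‖ * (‖u₁ x‖ + ‖u x‖) := by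
  sorry

/-- **S2 — THE THRESHOLD WINDOW** (`ThresholdEstimate`, no certificate hypothesis: the frequency
window `|ω − mω₊| < ε` is exactly what `CertificateFamily` does not cover, and the header's
"threshold-adapted certificates (k₋ → 0 adapted end conditions)" are not typed in the route, so the
stub is stated by the OUTPUT the summation needs). Plausibly true: real modes are excluded for
all `ω ∈ ℝ ∖ {0}`, thresholds included (arXiv:1302.6902 Thm. 1.6), and the quantitative theorem
there bounds `sup_𝒜 |W⁻¹|` on every frequency set with `|ω| + |ω|⁻¹ + |m| + |l|` bounded — again
thresholds included — so the Green's function `u_hor(x_<) u_out(x_>)/W` is bounded on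
`core × ℝ` uniformly on the window (for `y < x` one meets `u_hor(y) ≈ B e^{−iky}`, bounded even at
`k = 0`; the linear growth of `u_out` at `−∞` when `k = 0` never enters), which gives the sup-norm
form `sup_core (‖u‖ + ‖u'‖) ≤ C ∫ ‖F‖`; from the non-superradiant side the `Q^T` identity
`ω|u₊|² + k|u₋|² = ∫ Im(F ū)` even makes DRSR's horizon term `|ωk||u₋|² ≤ |ω| ∫‖F‖‖u‖` harmless
up to `k = 0⁺`. For the Teukolsky case see arXiv:1910.02854. Why it might fail: the BILINEAR
(multiplier-type) form is stronger than resolvent bounds when `F` is spread out, and from the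
superradiant side `k → 0⁻` the certificate's end inequality `0 ≤ γ₋ + k²α₋ − 2kb₋` loses the terms
that pay for the flux climb `(Im β')² ≤ (α' + 2Re β)(γ' − 2P Re β)`, so optimal margins `η(k)` may
tend to `0` at the threshold although no mode appears — that would falsify uniformity in this form
(and with it the Whiting-free bounded-frequency claim) while leaving DRSR's route intact. Cheapest
falsifier: the card's staged toy (`P = Ω(x)² − V₀ sech² x`) with `k₋ → 0`, SDP margin vs. `k₋`.
Size: M/L. Sources: arXiv:1302.6902 (Thms. 1.6, 1.7 and the quantitative Wronskian bound),
arXiv:1910.02854, arXiv:1402.7034 (Prop. 8.7.4: the horizon term carries the factor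
`|ω(ω − ω₊m)|`), doi:10.1016/0167-6911(95)00063-1. -/
theorem stub_thresholdEstimate : ∀ (M a₀ : ℝ), 0 < M → 0 ≤ a₀ → a₀ < M → ∀ (ωh Λh ω₀ δ Rc : ℝ), 0 < ω₀ → 0 < δ → ∃ ε : ℝ, 0 < ε ∧ ∃ C : ℝ, ∀ (a : ℝ), 0 ≤ a → a ≤ a₀ → ∀ (R : ℝ → ℝ), (∀ x, HasDerivAt R (((R x) ^ 2 - 2 * M * R x + a ^ 2) / ((R x) ^ 2 + a ^ 2)) x) → (∀ x, Literature.Geometry.Lorentzian.Kerr.rPlus M a < R x) → Filter.Tendsto R Filter.atBot (nhds (Literature.Geometry.Lorentzian.Kerr.rPlus M a)) → Filter.Tendsto R Filter.atTop Filter.atTop → ∀ (ω Λ : ℝ) (m : ℤ), |(m : ℝ)| * (|(m : ℝ)| + 1) ≤ Λ → 2 * |a * m * ω| ≤ Λ → |ω| ≤ ωh → Λ ≤ Λh → ω₀ ≤ ω → |ω - m * Literature.Geometry.Lorentzian.Kerr.horizonAngularVelocity M a| ≤ ε → ∀ (k : ℝ), k = ω - m * Literature.Geometry.Lorentzian.Kerr.horizonAngularVelocity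 M a → ∀ (u u₁ u₂ F : ℝ → ℂ), (∀ x, HasDerivAt u (u₁ x) x ∧ HasDerivAt u₁ (u₂ x) x) → Continuous F → MeasureTheory.Integrable (fun x ↦ ‖F x‖ * (‖u₁ x‖ + ‖u x‖)) → (∀ (x r P : ℝ), r = R x → P = ω ^ 2 - ((4 * M * r * a * m * ω - a ^ 2 * (m : ℝ) ^ 2 + (r ^ 2 - 2 * M * r + a ^ 2) * Λ) / (r ^ 2 + a ^ 2) ^ 2 + (r ^ 2 - 2 * M * r + a ^ 2) * (3 * r ^ 2 - 4 * M * r + a ^ 2) / (r ^ 2 + a ^ 2) ^ 3 - 3 * (r ^ 2 - 2 * M * r + a ^ 2) ^ 2 * r ^ 2 / (r ^ 2 + a ^ 2) ^ 4) → u₂ x + (P : ℂ) * u x = F x) → (∃ A : ℂ, Filter.Tendsto (fun x : ℝ ↦ u x - A * Complex.exp (Complex.I * ω * x)) Filter.atTop (nhds 0) ∧ Filter.Tendsto (fun x : ℝ ↦ u₁ x - Complex.I * ω * A * Complex.exp (Complex.I * ω * x)) Filter.atTop (nhds 0)) → (∃ B : ℂ, Filter.Tendsto (fun x : ℝ ↦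 u x - B * Complex.exp (-(Complex.I * k * x))) Filter.atBot (nhds 0) ∧ Filter.Tendsto (fun x : ℝ ↦ u₁ x + Complex.I * k * B * Complex.exp (-(Complex.I * k * x))) Filter.atBot (nhds 0)) → ∀ (x₁ x₂ : ℝ), x₁ ≤ x₂ → Literature.Geometry.Lorentzian.Kerr.rPlus M a * (1 + δ) ≤ R x₁ → R x₂ ≤ Rc → ∫ x in x₁..x₂, (‖u₁ x‖ ^ 2 + ‖u x‖ ^ 2) ≤ C * ∫ x, ‖F x‖ * (‖u₁ x‖ + ‖u x‖) := by
  sorry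

/-- **S3 — WHITING-FREE INTEGRATED DECAY** (`CoreEstimate → ThresholdEstimate → KerrWaveILED`: DRSR
III with Prop. 9.7.1 replaced). The printed proof of Thm. 3.2 (25) (arXiv:1402.7034 §§4–9, 11, 13:
reduction to smooth compactly supported data, red-shift `N`, Carter separation for sufficiently
integrable functions, the frequency-localised currents of §8 in the ranges `𝓖_♯, 𝓖^♯, 𝓖_♮,
𝓖_{<♭}` and `𝓖_♭ ∩ {|ω| ≤ ω_low}` — none of which uses mode stability —, summation §9, the
continuity argument in `a` of §11 and the a-posteriori boundedness of §13) goes through verbatim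
except in `𝓖_♭ ∩ {|ω| ≥ ω_low}`, where Prop. 8.7.4 leaves the horizon term
`∫_{ω_low ≤ |ω| ≤ ω_high} Σ |u(−∞)|² dω` that Prop. 9.7.1 bounds by arXiv:1302.6902. Replace: choose
`ω_low ≤ min(ε_thr, ε)` with `ε_thr` the window of `ThresholdEstimate` (at `ω₀ := ω_low`) and use
(a) `CoreEstimate` on the superradiant ε-interior, (b) `ThresholdEstimate` on `|ω − mω₊| ≤ ε_thr`,
(c) the `Q^T` identity `ω|u₊|² + k|u₋|² = ∫ Im(F ū)` on the non-superradiant remainder — each a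
bilinear phase-space bound of the shape Theorem 8.1 sums (Remark 8.3), the outgoing/ingoing
asymptotics of its `u` being DRSR's Lemma 5.4.1 / (eq:b±); then the mirror branches
`(ω, m) ↦ (−ω, −m)` (conjugation) and `a ↦ −a` (`φ ↦ −φ`), and finally the reduction of the
Kerr–Schild-leaf consequence form to (25) recorded in the docstring of
`drsr_wave_integrated_decay_kerr` (finite speed of propagation, far-region `J^T` comparison,
`{‖y‖ ≤ R} ⊆ {r ≤ R}`). As a bare implication S3 is true because its conclusion is DRSR's theorem;
its value is the Whiting-free derivation. Why it might fail (as a LINE step, not as a proposition):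
the interface — Theorem 8.1 needs, for summation, currents equal to fixed explicit functions on
`r* ≥ R*_∞` (Remark 8.2), whereas (a)/(b) deliver abstract core bounds with `∫_ℝ ‖F‖(‖u'‖ + ‖u‖)` on
the right, so the large-`r` gluing of §9.3–9.6 must be redone with the abstract bound feeding only
the horizon/near-region bookkeeping (Shlapentokh-Rothman's own route from the Wronskian bound to
Thm. 1.7 shows the way); and the sheer size (XL: the whole of DRSR III minus one page). Sources:
arXiv:1402.7034 (Thm. 3.2, Thm. 8.1, Props. 8.7.4, 9.1.1, 9.7.1, §§11, 13), arXiv:1302.6902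
(Thm. 1.7), arXiv:1010.5132, arXiv:0811.0354 §5. -/
theorem stub_iledOfCoreEstimates : (∀ (M a₀ : ℝ), 0 < M → 0 ≤ a₀ → a₀ < M → ∀ (ωh Λh ε δ Rc : ℝ), 0 < ε → 0 < δ → ∃ C : ℝ, ∀ (a : ℝ), 0 ≤ a → a ≤ a₀ → ∀ (R : ℝ → ℝ), (∀ x, HasDerivAt R (((R x) ^ 2 - 2 * M * R x + a ^ 2) / ((R x) ^ 2 + a ^ 2)) x) → (∀ x, Literature.Geometry.Lorentzian.Kerr.rPlus M a < R x) → Filter.Tendsto R Filter.atBot (nhds (Literature.Geometry.Lorentzian.Kerr.rPlus M a)) → Filter.Tendsto R Filter.atTop Filter.atTop → ∀ (ω Λ : ℝ) (m : ℤ), |(m : ℝ)| * (|(m : ℝ)| + 1) ≤ Λ → 2 * |a * m * ω| ≤ Λ → |ω| ≤ ωh → Λ ≤ Λh → ε ≤ ω → ω + ε ≤ m * Literature.Geometry.Lorentzian.Kerr.horizonAngularVelocity M a → ∀ (k : ℝ), k = ω - m * Literature.Geometry.Lorentzian.Kerr.horizonAngularVelocity M a → ∀ (u u₁ u₂ F :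 ℝ → ℂ), (∀ x, HasDerivAt u (u₁ x) x ∧ HasDerivAt u₁ (u₂ x) x) → Continuous F → MeasureTheory.Integrable (fun x ↦ ‖F x‖ * (‖u₁ x‖ + ‖u x‖)) → (∀ (x r P : ℝ), r = R x → P = ω ^ 2 - ((4 * M * r * a * m * ω - a ^ 2 * (m : ℝ) ^ 2 + (r ^ 2 - 2 * M * r + a ^ 2) * Λ) / (r ^ 2 + a ^ 2) ^ 2 + (r ^ 2 - 2 * M * r + a ^ 2) * (3 * r ^ 2 - 4 * M * r + a ^ 2) / (r ^ 2 + a ^ 2) ^ 3 - 3 * (r ^ 2 - 2 * M * r + a ^ 2) ^ 2 * r ^ 2 / (r ^ 2 + a ^ 2) ^ 4) → u₂ x + (P : ℂ) * u x = F x) → (∃ A : ℂ, Filter.Tendsto (fun x : ℝ ↦ u x - A * Complex.exp (Complex.I * ω * x)) Filter.atTop (nhds 0) ∧ Filter.Tendsto (fun x : ℝ ↦ u₁ x - Complex.I * ω * A * Complex.exp (Complex.I * ω * x)) Filter.atTop (nhds 0)) → (∃ B : ℂ, Filter.Tendsto (fun x : ℝ ↦ u x - B * Complex.exp (-(Complex.I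 * k * x))) Filter.atBot (nhds 0) ∧ Filter.Tendsto (fun x : ℝ ↦ u₁ x + Complex.I * k * B * Complex.exp (-(Complex.I * k * x))) Filter.atBot (nhds 0)) → ∀ (x₁ x₂ : ℝ), x₁ ≤ x₂ → Literature.Geometry.Lorentzian.Kerr.rPlus M a * (1 + δ) ≤ R x₁ → R x₂ ≤ Rc → ∫ x in x₁..x₂, (‖u₁ x‖ ^ 2 + ‖u x‖ ^ 2) ≤ C * ∫ x, ‖F x‖ * (‖u₁ x‖ + ‖u x‖)) → (∀ (M a₀ : ℝ), 0 < M → 0 ≤ a₀ → a₀ < M → ∀ (ωh Λh ω₀ δ Rc : ℝ), 0 < ω₀ → 0 < δ → ∃ ε : ℝ, 0 < ε ∧ ∃ C : ℝ, ∀ (a : ℝ), 0 ≤ a → a ≤ a₀ → ∀ (R : ℝ → ℝ), (∀ x, HasDerivAt R (((R x) ^ 2 - 2 * M * R x + a ^ 2) / ((R x) ^ 2 + a ^ 2)) x) → (∀ x, Literature.Geometry.Lorentzian.Kerr.rPlus M a < R x) → Filter.Tendsto R Filter.atBot (nhds (Literature.Geometry.Lorentzian.Kerr.rPlus M a)) →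 Filter.Tendsto R Filter.atTop Filter.atTop → ∀ (ω Λ : ℝ) (m : ℤ), |(m : ℝ)| * (|(m : ℝ)| + 1) ≤ Λ → 2 * |a * m * ω| ≤ Λ → |ω| ≤ ωh → Λ ≤ Λh → ω₀ ≤ ω → |ω - m * Literature.Geometry.Lorentzian.Kerr.horizonAngularVelocity M a| ≤ ε → ∀ (k : ℝ), k = ω - m * Literature.Geometry.Lorentzian.Kerr.horizonAngularVelocity M a → ∀ (u u₁ u₂ F : ℝ → ℂ), (∀ x, HasDerivAt u (u₁ x) x ∧ HasDerivAt u₁ (u₂ x) x) → Continuous F → MeasureTheory.Integrable (fun x ↦ ‖F x‖ * (‖u₁ x‖ + ‖u x‖)) → (∀ (x r P : ℝ), r = R x → P = ω ^ 2 - ((4 * M * r * a * m * ω - a ^ 2 * (m : ℝ) ^ 2 + (r ^ 2 - 2 * M * r + a ^ 2) * Λ) / (r ^ 2 + a ^ 2) ^ 2 + (r ^ 2 - 2 * M * r + a ^ 2) * (3 * r ^ 2 - 4 * M * r + a ^ 2) / (r ^ 2 + a ^ 2) ^ 3 - 3 * (r ^ 2 - 2 * M * r + a ^ 2) ^ 2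 * r ^ 2 / (r ^ 2 + a ^ 2) ^ 4) → u₂ x + (P : ℂ) * u x = F x) → (∃ A : ℂ, Filter.Tendsto (fun x : ℝ ↦ u x - A * Complex.exp (Complex.I * ω * x)) Filter.atTop (nhds 0) ∧ Filter.Tendsto (fun x : ℝ ↦ u₁ x - Complex.I * ω * A * Complex.exp (Complex.I * ω * x)) Filter.atTop (nhds 0)) → (∃ B : ℂ, Filter.Tendsto (fun x : ℝ ↦ u x - B * Complex.exp (-(Complex.I * k * x))) Filter.atBot (nhds 0) ∧ Filter.Tendsto (fun x : ℝ ↦ u₁ x + Complex.I * k * B * Complex.exp (-(Complex.I * k * x))) Filter.atBot (nhds 0)) → ∀ (x₁ x₂ : ℝ), x₁ ≤ x₂ → Literature.Geometry.Lorentzian.Kerr.rPlus M a * (1 + δ) ≤ R x₁ → R x₂ ≤ Rc → ∫ x in x₁..x₂, (‖u₁ x‖ ^ 2 + ‖u x‖ ^ 2) ≤ C * ∫ x, ‖F x‖ * (‖u₁ x‖ + ‖u x‖)) → ∀ [Literature.Geometry.Lorentzian.Kerr.Facts] [Literature.Geometry.Lorentzian.Kerr.SliceFacts] (M a : ℝ),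 Literature.Geometry.Lorentzian.Kerr.IsSubextremal M a → ∀ R : ℝ, ∃ C : ENNReal, C < ⊤ ∧ ∀ ψ : Literature.Geometry.Lorentzian.Kerr.exterior M a → ℝ, Literature.Geometry.Lorentzian.IsAdmissibleKerrWave M a ψ → ∫⁻ τ in Set.Ioi (0 : ℝ), Literature.Geometry.Lorentzian.localSliceEnergy (Literature.Geometry.Lorentzian.Kerr.exterior M a) ψ τ R ≤ C * Literature.Geometry.Lorentzian.sliceSobolevEnergy (Literature.Geometry.Lorentzian.Kerr.exterior M a) ψ 0 2 0 Set.univ := by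
  sorry

/-- **S4 — THE ARCHITECTURE: NONLINEAR CAPTURE FROM LINEAR DECAY** (`KerrWaveILED → KerrCapture`).
The Ma–Szeftel / DHRT / Klainerman–Szeftel / Hintz passage from integrated decay to sub-extremal
Kerr stability in the tree's form `K`: (i) the TEUKOLSKY ANALOGUE of S1–S3 — boundedness and decay
for spin `±2` in the full sub-extremal range (arXiv:2007.07211 frequency space, arXiv:2302.08916
physical space), whose only non-constructive input is again real-axis mode stability, now for the
Teukolsky radial ODE (arXiv:1910.02854), to be replaced by spin-weighted certificates if the whole
line is to be Whiting-free (the crux's informal "and the Teukolsky analogue"); (ii) linear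
stability and the generalised Regge–Wheeler / wave-type estimates the nonlinear scheme consumes, of
which `KerrWaveILED` is the `s = 0` instance (arXiv:2205.14808); (iii) the GCM-sphere / modulation
bootstrap closing nonlinear stability with final parameters `(M′, a′)` (arXiv:2104.11857 for
`|a| ≪ M`; arXiv:2104.08222 for `a = 0`, codimension 3; the full range `|a| < M` as claimed by Hintz
arXiv:2606.28253 and the robustness framework arXiv:2410.02341, both as cited by the route header);
(iv) the passage from the printed conclusions to the tree's rendering of `K`: `H^s_δ`-closeness on
the horizon-penetrating slice `Kerr.slice a M` (`r₀ = M ∈ (r₋, r₊)`), far-origin sojourn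
completeness of `𝓘⁺`, and `Spacetime.ConvergesToKerr` (unweighted `Cᵏ` sup on Kerr–Schild late
slabs). As a bare implication S4 holds iff `K` does (its hypothesis is DRSR's theorem), so it
inherits the crux's own audit point. Why it might fail: the RENDERING of `K` may over-ask while
every printed theorem holds — `Cᵏ` sup over entire Kerr–Schild slabs out to `i⁰`, the sojourn
form of completeness with ray origins in `{‖y‖ ≥ afRadius + 1}`, `H^s_δ`-smallness measured on
the slice `r ≥ M` inside the horizon (refuter audit requested by the route header against Hintz's
main theorem); and as a LINE step it is the largest item of the summit short of the large-data
half. Size: open-problem in-tree (in print modulo (iv)). Sources: arXiv:2606.28253,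
arXiv:2410.02341, arXiv:2104.11857, arXiv:2205.14808, arXiv:2104.08222, arXiv:2007.07211,
arXiv:2302.08916, arXiv:1910.02854, arXiv:0811.0354 (Conj. 5.1). -/
theorem stub_kerrCaptureOfILED : (∀ [Literature.Geometry.Lorentzian.Kerr.Facts] [Literature.Geometry.Lorentzian.Kerr.SliceFacts] (M a : ℝ), Literature.Geometry.Lorentzian.Kerr.IsSubextremal M a → ∀ R : ℝ, ∃ C : ENNReal, C < ⊤ ∧ ∀ ψ : Literature.Geometry.Lorentzian.Kerr.exterior M a → ℝ, Literature.Geometry.Lorentzian.IsAdmissibleKerrWave M a ψ → ∫⁻ τ in Set.Ioi (0 : ℝ), Literature.Geometry.Lorentzian.localSliceEnergy (Literature.Geometry.Lorentzian.Kerr.exterior M a) ψ τ R ≤ C * Literature.Geometry.Lorentzian.sliceSobolevEnergy (Literature.Geometry.Lorentzian.Kerr.exterior M a) ψ 0 2 0 Set.univ) → ∀ [Literature.Geometry.Lorentzian.Kerr.Facts] [Literature.Geometry.Lorentzian.Kerr.SliceFacts], ∃ (s : ℕ) (δ : ℝ) (k : ℕ), ∀ (M a : ℝ) (h : Literature.Geometry.Lorentzian.Kerr.IsSubextremal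 M a), ∀ η > (0 : ℝ), ∃ ε > (0 : ℝ), ∀ (D : Literature.Geometry.Lorentzian.InitialDataSet 𝓘(ℝ, Literature.Geometry.Lorentzian.E3) (Literature.Geometry.Lorentzian.Kerr.slice a M)) [D.metric.HasLeviCivita], D.IsVacuumConstraintSolution → Literature.Geometry.Lorentzian.InitialDataSet.dataWeightedSobolevEDist s δ D (Literature.Geometry.Lorentzian.Kerr.data M a M h.pos.le) < ENNReal.ofReal ε → ∀ 𝒟 : Literature.Geometry.Lorentzian.VacuumCauchyDevelopment D, 𝒟.IsMaximal → ∃ (M' a' : ℝ) (𝒟oc : Set 𝒟.carrier), Literature.Geometry.Lorentzian.Kerr.IsSubextremal M' a' ∧ |M' - M| + |a' - a| ≤ η ∧ (∀ [𝒟.metric.HasLeviCivita], ∃ B₀ : Set (Literature.Geometry.Lorentzian.Kerr.slice a M), IsCompact B₀ ∧ ∀ σ : ℝ, 0 < σ → ∃ B₁ : Set (Literature.Geometry.Lorentzian.Kerr.slice a M), IsCompact B₁ ∧ ∀ p : Literature.Geometry.Lorentzian.Kerr.slice a M, Literature.Geometry.Lorentzian.Kerr.afRadius a M + 1 ≤ ‖(p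 : Literature.Geometry.Lorentzian.E3)‖ → p ∉ B₁ → ∀ (γ : ℝ → 𝒟.carrier) (dom : Set ℝ), 𝒟.metric.IsNormalisedNullRayFrom 𝒟.timeOrientation 𝒟.embed 𝒟.normal p γ dom → ¬ BddAbove dom ∨ ENNReal.ofReal σ ≤ Literature.Geometry.Lorentzian.sojournTime γ dom (𝒟.metric.causalFuture 𝒟.timeOrientation (𝒟.embed '' B₀))) ∧ 𝒟.toSpacetime.ConvergesToKerr 𝒟oc M' a' k := by
  sorry

/-! ## Composition: the crux BY NAME from the four stubs (real proof, no `sorry`) -/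

/-- **`CertificatesToKerrCapture` from S1–S4**: given `hCF : CertificateFamily`, S1 turns the
certificates into the superradiant-interior core estimate, S2 supplies the threshold window, S3
turns both into integrated local energy decay for scalar waves on every sub-extremal Kerr, and S4
turns that into the waypoint `K`; the result is the crux BY NAME (`CertificatesToKerrCapture`
unfolds to `CertificateFamily → K` with `K` syntactically the legend `KerrCapture`,
`certificatesToKerrCapture_iff`). -/
theorem CertificatesToKerrCapture_of :
    Sig.stub_coreEstimate → Sig.stub_thresholdEstimate → Sig.stub_iledOfCoreEstimates →
      Sig.stub_kerrCaptureOfILED → CertificatesToKerrCapture :=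
  fun h₁ h₂ h₃ h₄ hCF ↦ h₄ (h₃ (h₁ hCF) h₂)

/-- The crux by name, closed modulo the four registered stubs (axioms: `sorryAx` from the stubs
only; `CertificatesToKerrCapture_of` itself is sorry-free). -/
theorem certificatesToKerrCapture_of_stubs : CertificatesToKerrCapture :=
  CertificatesToKerrCapture_of stub_coreEstimate stub_thresholdEstimate stub_iledOfCoreEstimates
    stub_kerrCaptureOfILED

end Summit.FinalStateConjecture.FinalStateConjecture.Cruxes.CertificatesToKerrCapture.Birth

end
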